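import Mathlib
import HarnessLib
import HarnessLib.Audit
import Summits.HodgeConjecture.Statement
import Literature.AlgebraicGeometry.ShimuraVarieties.UnitaryBallQuotientDatum
import Literature.AlgebraicGeometry.HodgeTheory.ClassesSupportedOn
import Literature.AlgebraicGeometry.HodgeTheory.HardLefschetzThreefold
import Literature.AlgebraicGeometry.HodgeTheory.HodgeConjecture
import Literature.AlgebraicGeometry.HodgeTheory.ComplexGysin

/-!
Route: EndoscopicMiddleDegree

# Route EndoscopicMiddleDegree — middle-degree Hodge classes on compact 4- /6-ball quotients: theta
span plus a Hecke-enveloped, supersingular-seeded kernel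

DECLARED SECTOR ROUTE (idea card endoscopic-middle-third-ball-quotients; re-open of
EndoscopicBallQuotient). Sector: smooth
projective X/ℂ of dimension 2n = 2(m+1) ∈ {4, 6} carrying a `UnitaryBallQuotientDatum (2n) X` (X(ℂ)
≅ Γ\𝔹²ⁿ, Γ a torsion-free
congruence subgroup of U(V), V anisotropic hermitian over a CM field E/F of signature (2n,1) at one
real place, definite at the
others: BMM's compact Shimura varieties of simple unitary type). It suffices to show X =
MiddleDegreeStep: on such X the Hodge
conjecture PROPAGATES from degree 2n−2 into the middle degree 2n — the degree BMM Cor. 2 (n ∉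
]p/3,2p/3[) can never reach when
p = 2n, and the one where the whole conjecture lives (BFNP Lemma 48).

REVISED LINE (rev 3, 2026-08-16, promote pass; absorbs the crux chain on MiddleThetaSpan:
Disproof.lean F1–F11, triage r1-3's
ε-negative CAP kill pattern, the picked line conjugate-dimension-sieve). Every rational Hodge
(n,n)-class c splits over its
ℚ-Hecke pieces into a THETA-VISIBLE part and a THETA-ORTHOGONAL part, and the route now treats the
two by different machines:
(1) THETA WORLD TW(D) := SCⁿ(D) ⊔ {codimension-n cycles ON the codimension-(n−1) special cycles} ⊔
Hdg^{n−1,n−1}_ℚ·N¹ — the R1-safe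
(fixed-level) rendering C″ of BMM Thm 71's product shape (Disproof F3/F9, glue proved); TW ⊆
algebraic classes given HC one
degree down. OrthogonalSplit (support, pure Hodge theory: hard Lefschetz + Hodge–Riemann make the
cup form non-degenerate on
TW because TW contains every non-primitive rational Hodge class): Hdg^{n,n}_ℚ ⊆ TW + span{rational
Hodge e : e ∪ TW = 0}.
(2) THE KERNEL E(D) := rational Hodge (n,n)-classes cup-orthogonal to TW. NEW FINDING (triage r1-3,
verified here): conditionally
on Arthur's multiplicity formula E ≠ 0 already at n = 2 — GL₂-CAP packets ψ = ρ⊠R₂ ⊞ χ₀ on U(4,1)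
with ε(½, ρ×χ₀⁻¹) = −1 (or
L(½) = 0) carry RATIONAL, TATE-type, purely (2,2) Hecke pieces whose members are theta lifts from NO
4-dimensional W
(Gan–Ichino dichotomy is incoherent), hence orthogonal to every special cycle,
cycle-on-special-cycle and divisor product: the
first place on ball quotients where HC needs non-geodesic cycles ('higher Blasius–Rogawski classes',
one dimension earlier
than the old route text bet). So MiddleThetaSpan (old heart, kept, rank 2; crux chain CONCLUDED
2026-08-16: all three lines dead at the theta stub, negative lemma
`MiddleThetaSpan_false_of_epsNegativeCapWitness` landed p80039) is conditionally false at m = 1, and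
the route's claim is re-cut: OrthogonalEnveloped (crux, the automorphic heart, absolute-Hodge-free):
every e ∈ E is fixed by
a ℚ-rational ALGEBRAIC self-correspondence action P of X with purely (n,n) image — by the
coefficient-conjugation sieve +
theta spanning of visible pieces + CoreVanishing, the pieces meeting E are theta-invisible CAP
pieces (or cores, bet: none),
and their ℚ-Hecke idempotents ARE such P (Hecke correspondences are algebraic).
IsotypicMiddleClassesAlgebraic (crux,
hardest): P-isotypic rational classes are algebraic — LITERALLY the restriction of
SupersingularIsotypicLift's LIFT
(stmt-HodgeConjecture-3048) to these X (proved: LIFT → ours), but here with a SUPPLY OF SEEDS LIFT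
lacks in general: at
every inert hyperspecial prime the basic (supersingular) locus of X̄ is HALF-dimensional
(Vollaard–Wedhorn: closed
Bruhat–Tits strata = generalized Deligne–Lusztig varieties of U_{2n+1}(p) of dimension n) and
Xiao–Zhu's theorem makes its
components span the Tate classes of the special fibre in V-general Hecke pieces — CAP Satake
parameters ARE V-general — the
same definite inner form I that makes the ε-negative piece INVISIBLE to theta in characteristic 0
(incoherence at the real
place) UNIFORMIZES the basic locus in characteristic p (obstruction as resource); the piece being
algebraically cut and
pure (n,n), the Bloch–Esnault–Kerz criterion (tree fact BlochEsnaultKerzLifting, p > 2n+6) holds for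
every seed
combination automatically, leaving exactly ALG (algebraization of pro-K₀ classes:
SupersingularIsotypicLift's informal
crux stmt-HodgeConjecture-3116, attacked object-wise by PadicSemiregularLift P1/P3) as the open end.
X follows by the DICHOTOMY crux AlgebraicOrEnveloped (rev 11, route-repair g2: the deciding theorem
is now CRUX-ONLY and the route
file constructs no orientation family): given HC one degree down on X, every rational Hodge
(n,n)-class is ALGEBRAIC MODULO ENVELOPED
CLASSES — c ∈ algebraicClasses X n ⊔ span_ℂ{e rational : for SOME orientation family μ with Poincaré
duality and SOME γ ∈ N^{2n}H^{4n}(X×X),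
P_γ β = pr₁₊(pr₂*β ∪ γ) preserves rational classes, has purely (n,n) image and fixes e} — exactly
what OrthogonalSplit (Hodge theory) +
CupProductAlgebraic (Fulton 19.2) + OrthogonalEnveloped deliver (support glue
AlgebraicOrEnvelopedOfSplit = the rev-7 inlined glue moved out
of `closes`, PROVED in the planner's SketchGlue.lean rc 0, 0 sorries, attached as evidence), while
IsotypicMiddleClassesAlgebraic makes every
enveloped rational class algebraic; `closes (h₁ : IsotypicMiddleClassesAlgebraic) (h₂ :
AlgebraicOrEnveloped) (hS : SectorComplement)` is six
lines of lattice logic (sup_le / span_le). Because the ∃μ sits INSIDE AlgebraicOrEnveloped, the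
route file no longer imports
GysinKernelProofs / Motives.ComplexPointsOrientation, whose cones carried the 3 unproved named facts
(Deligne1974 Gysin kernel, GluckTwist,
IntersectionLattice orientability) that kept provers away: import cone 172 → 88 modules, 0 unproved
facts.
Pay-off unchanged: HC for compact arithmetic ball-quotient FOURFOLDS modulo Lefschetz (1,1) + hard
Lefschetz
(FourfoldHodge), SIXFOLDS modulo BMM Cor. 2 in degree 4. Frame: SectorComplement : X →
HodgeConjecture (declared, NOT claimed).
Lean: `∀ (m : ℕ) (X : Literature.AlgebraicGeometry.Motives.SchemeOver ℂ), 1 ≤ m → m ≤ 2 → Nonempty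
(Literature.AlgebraicGeometry.ShimuraVarieties.UnitaryBallQuotientDatum (2 * (m + 1)) X) → (∀ a :
Literature.AlgebraicGeometry.HodgeTheory.complexBetti X (2 * m),
Literature.AlgebraicGeometry.HodgeTheory.IsRationalClass a →
Literature.AlgebraicGeometry.HodgeTheory.IsOfHodgeType (2 * (m + 1)) X (2 * m) m m a → a ∈
Literature.AlgebraicGeometry.HodgeTheory.algebraicClasses X m) → ∀ c :
Literature.AlgebraicGeometry.HodgeTheory.complexBetti X (2 * (m + 1)),
Literature.AlgebraicGeometry.HodgeTheory.IsRationalClass c →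
Literature.AlgebraicGeometry.HodgeTheory.IsOfHodgeType (2 * (m + 1)) X (2 * (m + 1)) (m + 1) (m + 1)
c → c ∈ Literature.AlgebraicGeometry.HodgeTheory.algebraicClasses X (m + 1)`

## Assembly
Deciding theorem (rev 11, crux-only, native OK): `closes (h₁ : IsotypicMiddleClassesAlgebraic) (h₂ :
AlgebraicOrEnveloped) (hS : SectorComplement) :
_root_.HodgeConjecture` — for m ∈ {1,2}, X with a datum D and HC in degree 2m on X, a rational Hodge
(n,n)-class c lies by h₂ in
algebraicClasses X n ⊔ span{enveloped rational classes}; `sup_le le_rfl (span_le …)`: each enveloped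
generator e comes WITH its orientation
family μ (Poincaré duality) and its algebraic correspondence γ (rationality-preserving, purely (n,n)
image, P e = e), so h₁ μ … γ … e gives
e ∈ algebraicClasses X n; this is MiddleDegreeStep, and SectorComplement (hS) carries the sector to
the summit. The item `Assembly`
(rev-7 type IsotypicMiddleClassesAlgebraic → OrthogonalEnveloped → OrthogonalSplit →
CupProductAlgebraic → SectorComplement → HodgeConjecture,
PROVED: endoscopicMiddleDegree_assembly_proof) stays as the proved record of the rev-7 deciding
path; it is implied by the rev-11 one through
AlgebraicOrEnvelopedOfSplit. WIRING of the cruxes outside the `closes` cone (typed, not prose):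
OrthogonalEnveloped → AlgebraicOrEnveloped by the
support AlgebraicOrEnvelopedOfSplit : CupProductAlgebraic → OrthogonalSplit → OrthogonalEnveloped →
AlgebraicOrEnveloped (provable now, candidate
proof attached); MiddleThetaSpan → OrthogonalEnveloped by the support EnvelopedOfThetaSpan (rev 10:
theta spans everything ⟹ the kernel E is ZERO by
Hodge–Riemann, `hodgeClass_eq_zero_of_cup_orthogonal` of
Theorems/EndoscopicMiddleDegreeOrthogonalSplit + landed Negative/TwoSummands ⟹ enveloped by
γ = 0) and → MiddleDegreeStep by ThetaStep (PROVED, thetaStep_proof). The two Hodge-theory supports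
are PROVED MODULO NAMED FACTS in landed Theorems
files — orthogonalSplit_of_kaehlerPackage (facts Grothendieck1969_supportedClasses_le_hodgeConiveau,
exists_deRhamIsoFamily,
hardLefschetz_hodgeRiemann) and cupProductAlgebraic_of_span_chernCharacter (facts
span_holomorphicBundleChernCharacter_eq_algebraicClasses,
nonempty_hodgeModel) — so `derived` closure of AlgebraicOrEnveloped waits on exactly those five
Literature facts plus OrthogonalEnveloped.
MiddleThetaSpan's crux chain has CONCLUDED (lead line conjugate-dimension-sieve and both alternates
dead at the theta stub; standing disprover landed
Negative/SupportWidening, TwoSummands, AtZeroLefschetz, RankBound; stub_sieve and the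
Hecke-idempotent vocabulary landed as supports and feed
OrthogonalEnveloped verbatim), and its negative lemma
`MiddleThetaSpan_false_of_epsNegativeCapWitness` (EpsNegativeCapWitness → ¬MiddleThetaSpan,
p80039) is the formal certificate that the kernel E is non-empty; the decl is KEPT (not dropped)
because seven landed Theorems files name it.
OrthogonalEnveloped's standing disprover (Cruxes/OrthogonalEnveloped/Disproof.lean F1/F1′, landed
Negative/EnvelopeOfAlgebraic p80733) proved
that it — and hence AlgebraicOrEnveloped — FOLLOWS from HC in degree 2n on the sector (normalised
exterior squares e×e/⟨e,e⟩ envelope algebraic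
classes): no kill short of ¬HC exists for either; all risk of the line is provability.

Rationale: WHY THIS LINE. On a compact ball quotient a cohomology class IS a sum of cohomological automorphic
representations π = A(a,b) ⊗ π_f
(Matsushima; Vogan–Zuckerman), and BMM (BergeronMillsonMoeglin2016Balls = arXiv:1306.1515, Thm 4,
Thm 71 pp.39–40, Cor. 2) prove HC away
from the middle third by showing that there every π is a theta lift whose Kudla–Millson classes are
special cycles times (1,1)-classes;
the range enters only through Prop. 80 (p.53), an ENDOSCOPIC wall. The crux chain run on the old
heart MiddleThetaSpan (2026-08-15/16:
7 crux ideas, 3 triagers, 3 checked lines, lead line conjugate-dimension-sieve, standing disprover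
F1–F11) taught three things this
revision builds in. (i) Absolute Hodge is NOT needed: σ ∈ Aut(ℂ) acting on COEFFICIENTS fixes
rational classes and commutes with the
ℚ-rational Hecke algebra, so a rational (n,n)-class has components only in pieces all of whose
conjugates carry (n,n) — Tate-type
singletons or cores (stub_sieve, provable now; BallQuotientHodgeAbsolute dropped). (ii) The
fixed-level product shape is R1-exposed;
the cure is C″ = cycles ON special cycles (Disproof F3/F9, glue proved, landed
Negative/SupportWidening p75146, TwoSummands p75147).
(iii) Decisive: at a = 1 the companion L-value of a GL₂-CAP parameter ψ = ρ⊠R₂ ⊞ χ₀ is the CENTRAL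
value L(½, ρ×χ₀⁻¹); when ε = −1
the A(2,2)-members (odd number of δ-places by Arthur's sign character ε_ψ(s_ψ) = ε(½,ρ×χ₀⁻¹);
Mœglin's two-element packet at a
discrete-series place; GanIchino arXiv:1409.6824 Thm 4.4 + (P2), proved for all parameters) are
automorphic, purely (2,2), RATIONAL
and Tate over E(χ₀), yet lift from no global W₄, so they are cup-orthogonal to the whole theta world
(triage r1-3
KillPatternEpsNegativeCAP.md; checked here: Adams–Johnson packet {A_𝔮 : Levi
U(2−i,i)×U(1−j,j)×U(2−k,k)}, only j = 1 is the degree-4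
discrete series, the others have R = 3 and live in H³/H⁵). BMM's a = 1 criterion (Thm 72 is printed
only for a > 1, p.42) is therefore
FALSE for CAP input, MiddleThetaSpan is conditionally false at m = 1, and HC on the sector genuinely
needs NON-theta cycles. The new line
keeps theta for what it does (OrthogonalSplit + the visible half inside OrthogonalEnveloped) and
brings a second area to bear on the
kernel: characteristic-p geometry of the SAME Shimura variety. The ε-negative piece is an algebraic
modular form on the definite inner
form I (compact at τ₁, switched at one finite place); at an inert hyperspecial p, I uniformizes the
basic locus of X̄_p (Rapoport–Zink),
which for U(1,2n) is exactly half-dimensional (VollaardWedhorn2011: closed Bruhat–Tits strata ≅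
generalized Deligne–Lusztig varieties of
U_{2n+1}(p) of dimension n; Muller arXiv:2110.00614), and Xiao–Zhu (arXiv:1707.05700 §1.1 Thm, parts
(1)–(2); Def. 19, Rem. 20) prove
H^{BM}_{2n}(basic) ≅ C(I(ℚ)\I(𝔸_f)/K) ⊗ V^{Tate} with injective cycle class map on V-general pieces
— and a CAP Satake parameter
(t₁,t₂) = (βq^{½}, β⁻¹q^{½}) is V-general (Rem. 20: tⱼ ≠ 1). So the theta-INVISIBLE classes are
precisely the ones VISIBLE to the
supersingular locus, and since their Hecke piece is algebraically cut out and pure (n,n),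
Bloch–Esnault–Kerz (BlochEsnaultKerz2014pAdic
Thm 1.3 = tree fact BlochEsnaultKerzLifting, p > 2n+6) lifts every seed combination to pro-K₀ with
NO absolute-Hodge / de Rham-rationality
input — the open end is ALG alone, the informal rank-2 crux of route SupersingularIsotypicLift
(stmt-HodgeConjecture-3116) and the target of
PadicSemiregularLift's object-lifting (FormalLiftingFromClassLifting stmt-13825,
FormalVectorBundlesAlgebraize stmt-14106). Imported areas:
endoscopy/theta (automorphic forms) → which pieces can carry rational classes and which are spanned;
Deligne–Lusztig/Rapoport–Zink geometry
+ geometric Satake (Xiao–Zhu) → seeds; p-adic K-theory (BEK) → lifting. What no other route does: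
SiuRepresentability is topological;
SupersingularIsotypicLift has the lifting engine but seeds only at Fermat/CM supersingular primes;
this is the only line where ENVELOPE
(Hecke idempotents) and SEEDS (basic-locus components, at EVERY inert prime) are both theorems for a
non-CM, non-Fermat family.

RANKED CRUXES. #0 MiddleDegreeStep (target, unchanged) — HC propagates from degree 2m into the
middle degree 2(m+1) on X with a datum,
m ∈ {1,2}. (why it might fail: = HC in the middle degree of compact arithmetic 4- /6-ball quotients;
false iff a non-algebraic rational
(2,2)/(3,3)-class exists — after this revision the prime suspects are the ε-negative CAP Tate
classes.) [arXiv:1306.1515, Deligne2000]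
#2 MiddleThetaSpan (crux, LEGACY HEART; chain concluded 2026-08-16 — three lines dead at the theta
stub, negative lemma landed p80039 —
kept as the typed negative edge, glued to `closes` by EnvelopedOfThetaSpan since rev 10, decl named
by seven landed Theorems files) — every rational Hodge
(m+1,m+1)-class lies in SC^{m+1} ⊔ SC^m·N¹ ⊔ Hdg^{m,m}_ℚ·N¹. (why it might fail: EXPECTED FALSE at m
= 1 modulo AMF for non-tempered ψ on
U(V): ε-negative GL₂-CAP Tate pieces are outside the span, C′ and C″ (triage r1-3); also R1 at ≥ 2
non-split places (F10/F11).)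
[arXiv:1306.1515, arXiv:1409.6824, arXiv:1409.3731, arXiv:1507.01432]
#3 IsotypicMiddleClassesAlgebraic (crux, HARDEST of the live line) — for μ with Poincaré duality, X
with a datum, γ ∈ N^{2n}H^{4n}(X×X) whose
action P = pr₁₊(pr₂*· ∪ γ) preserves rational classes and has purely (n,n) image: every rational c
with P c = c is algebraic. Literal
special case of SupersingularIsotypicLift.IsotypicClassesAlgebraic (stmt-3048;
`isotypicMiddle_of_lift` proved in Sketch), strictly weaker,
with its own complete attack: SupersingularSeeds (informal crux, below) + BEK + ALG. WHY THIS FORM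
IS EASIER than 'kernel classes are
algebraic': the hypothesis hands over an ALGEBRAIC projector with pure image, which is exactly what
makes BEK's Hodge condition automatic
for every cycle of the reduction inside the piece and confines the problem to one named open
statement (ALG) shared by two routes.
(why it might fail: only with HC; the attack fails if a_G(π_f) ≠ m_I(π_f) for CAP ψ (basic locus
under-produces: the kernel classes would
be 'exotic' Tate classes mod p too) or if ALG is false (a phantom pro-K₀ class; CostaSertoz2021
computes obstructions).)
[arXiv:1707.05700, arXiv:1203.2776, BlochEsnaultKerz2014pAdic, VollaardWedhorn2011,
arXiv:2110.00614, CostaSertoz2021]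
#4 OrthogonalEnveloped (crux, THE AUTOMORPHIC HEART, AH-free) — every rational Hodge (n,n)-class e
cup-orthogonal to TW(D) is fixed by some
P as in #3. Route proof: theta-orthogonal ⟹ primitive (TW ⊇ L·Hdg^{n−1,n−1}_ℚ, Hodge–Riemann); sieve
⟹ components only in Tate-type or
core pieces; visible Tate-type pieces have prim H^{n,n}[π_f] ⊆ (SC ⊔ SCon) ∩ piece (BMM Thm 71
seesaw at level K with K-invariant Schwartz
functions: traces of deeper-level products are cycles on special cycles — C″), hence zero component
by Hodge–Riemann on the piece;
CoreVanishing (bet) ⟹ no core components; what is left is a sum of theta-invisible Tate-type pieces,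
pure (n,n) at every conjugate, cut
out by a ℚ-rational idempotent of the Hecke algebra = the action of a ℚ-combination of Hecke
correspondences, algebraic on X×X. WHY THIS
FORM IS EASIER than MiddleThetaSpan: it asks theta only to SPAN THE VISIBLE pieces (both directions
in proved ranges: GI dichotomy, Rallis
inner product GQT arXiv:1207.4709 / Yamana 2014, KM, Cor. 62 for n ≤ 3) and asks of the invisible
ones only what endoscopy gives for
free (purity + Hecke cut), never a cycle. (why it might fail: ONE rational (2,2)-class in ONE core
piece — likeliest an even core Ψ₄ ∋ 0
⊞ χ₀ on U(4,1), tool-less today (= failure of 'Hodge ⟹ Tate-type' for these motives); or at m = 2 a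
non-discrete-series Adams–Johnson
member sharing π_f makes the CAP piece impure in H⁶.) [arXiv:1306.1515, arXiv:1409.6824,
arXiv:1207.4709, arXiv:1507.01432,
arXiv:1804.05047, zbl:0828.14012, Lieberman1968]
#5 AlgebraicOrEnveloped (crux, THE DICHOTOMY = deciding-path form of #4; rev 11) — given HC in
degree 2m on X, every rational Hodge
(n,n)-class lies in algebraicClasses X n ⊔ span{e rational : ∃ orientation family μ with Poincaré
duality, ∃ γ ∈ N^{2n}H^{4n}(X×X) with P_γ
rationality-preserving, purely (n,n)-valued, P_γ e = e}. Strictly weaker than OrthogonalSplit ∧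
CupProductAlgebraic ∧ #4 (support glue
AlgebraicOrEnvelopedOfSplit, proved in Sketch), implied by the target (Disproof F1: algebraic
classes are enveloped by normalised exterior
squares), and together with #3 EQUIVALENT to the target: it is the exact contract between the
automorphic side (which classes theta makes
algebraic, which ones endoscopy only cuts out purely) and the p-adic lifting side (#3). The ∃μ is
inside the statement so that `closes` builds no
orientation (clean import cone). Staff it THROUGH #4 + the two Hodge-theory supports, or directly.
(why it might fail: only with HC on the
sector — a rational (2,2)-class on a compact U(4,1) quotient that is neither theta-algebraic nor in
a pure Hecke-cut piece, likeliest in an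
even core Ψ₄ ∋ 0 ⊞ χ₀; provability risk: the Kähler-package / coniveau / Chern-character facts under
the two supports are L–XL formalizations.)
[arXiv:1306.1515, arXiv:1409.6824, arXiv:1507.01432, VoisinHodgeI2002, VoisinHodgeII2003,
BrosnanFangNiePearlstein2009]
#9 SectorComplement (auto-crux, conjecture-grade, DECLARED NOT CLAIMED) — MiddleDegreeStep →
HodgeConjecture: HC off the sector. [Deligne2000]
INFORMAL cruxes filed after this edit (no vocabulary for packets / integral models):
ThetaOrthogonalClassification (rank 5: the sieve
trichotomy + visible spanning + CAP purity, i.e. the automorphic content of #4 sentence by sentence)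
and SupersingularSeeds (rank 6: for
every inert hyperspecial v and every theta-invisible Tate-type piece N, the reduction N̄ ⊂
H^{2n}(X̄_v, ℚ_ℓ(n)) is spanned by Hecke
projections of closed Bruhat–Tits strata classes — Xiao–Zhu (1)(2) + V-generality of CAP parameters
+ the multiplicity comparison
a_G(A(n,n)⊗π_f) = m_I(𝟙⊗π_f), both signs η_{A(n,n)}(s_ψ) = η_𝟙(s_ψ) = +1 by the triage tables).
SUPPORT: OrthogonalSplit (Hodge theory: Hdg^{n,n}_ℚ ⊆ TW + span of the theta-orthogonal rational
Hodge classes; non-degeneracy of ∪ on TW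
from TW = (TW ∩ Prim) ⊕ L·Hdg^{n−1,n−1}_ℚ and Hodge–Riemann; PROVED MODULO FACTS:
orthogonalSplit_of_kaehlerPackage in
Theorems/EndoscopicMiddleDegreeOrthogonalSplit, conditional on
Grothendieck1969_supportedClasses_le_hodgeConiveau, exists_deRhamIsoFamily,
hardLefschetz_hodgeRiemann), CupProductAlgebraic (Fulton 19.2 / Voisin II 9.20; PROVED MODULO FACTS:
cupProductAlgebraic_of_span_chernCharacter in
Theorems/EndoscopicMiddleDegreeCupProductAlgebraicOfChernCharacter, conditional on
span_holomorphicBundleChernCharacter_eq_algebraicClasses and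
nonempty_hodgeModel), AlgebraicOrEnvelopedOfSplit (rev-11 glue CupProductAlgebraic → OrthogonalSplit
→ OrthogonalEnveloped → AlgebraicOrEnveloped =
the rev-7 inlined glue moved out of `closes`: TW ≤ algebraicClasses by
classesSupportedOn_le_supportedClasses with the datum's codimension fields and
by hypothesis + CupProductAlgebraic on the Lefschetz summand; the orthogonal span ≤ the enveloped
span by OrthogonalEnveloped at the complex
orientation family, Motives.ComplexPoints.isOrientableOver + OrientationFamily.hasPoincareDuality;
PROVED in SketchGlue.lean rc 0, evidence attached;
provable now in Theorems/ with those two imports), ThetaStep (legacy glue, PROVED: thetaStep_proof),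
EnvelopedOfThetaSpan (rev-10 glue MiddleThetaSpan → OrthogonalEnveloped: under the theta
span the kernel is zero by Hodge–Riemann and the zero class is enveloped by γ = 0; provable now
modulo hardLefschetz_hodgeRiemann),
FourfoldHodge (calibration, PROVED: fourfoldHodge_proof), Assembly (= type of `closes`,
non-tautological, PROVED:
endoscopicMiddleDegree_assembly_proof). The rev-7 deciding theorem took the two Hodge-theory
supports as hypotheses (needs_repair glue.non-crux-hypothesis, revs 7–10); rev 11
re-cut it crux-only through #5 and dropped the imports GysinKernelProofs / ComplexPointsOrientation
(3 unproved cone facts ⟶ 0). DROPPED rev 3: BallQuotientHodgeAbsolute (not load-bearing: the sieve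
is AH-free; refuter/retriage
had flagged it unstaffable), HigherBlasiusRogawskiClass (∃-statement needing a datum, unprovable in
Lean either way; its content — non-theta
rational classes — is now the conditional ε-negative phenomenon at p = 4, recorded in #2/#4),
informal 13438 TateTypePacketsTheta (its
clause (c) 'coherence follows from automorphy' is exactly what fails for ε-negative CAP packets) and
13465 (absolute-Hodge Galois leg,
superseded by the sieve).

KILL CRITERIA. (i) A rational (2,2)-class in a CORE piece of a compact U(4,1) quotient (even core Ψ₄
∋ 0 ⊞ χ₀ first) refutes
OrthogonalEnveloped's route proof (and #5's); if the class is moreover not enveloped by ANY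
algebraic correspondence it is ¬HC, i.e. ¬#4, ¬#5 and ¬target at once (Disproof F1). ⇒ close
`refuted:OrthogonalEnveloped` or pivot to a pure SIL-type statement. (ii) a_G ≠ m_I for the
ε-negative CAP π_f (sign discrepancy between
U(4,1)×compact and the definite I at the switched places), or Xiao–Zhu V-generality failing for the
relevant π_p: SupersingularSeeds dies,
#3 loses its seeds and the route is back to 'no cycle construction' ⇒ retire `exhausted` unless
Deligne–Mostow/moduli cycles (card B4)
revive it. (iii) A phantom pro-K₀ class (¬ALG) on ANY smooth projective W-scheme kills #3's attack
together with SupersingularIsotypicLift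
and PadicSemiregularLift's object route — informative either way. (iv) ¬MiddleThetaSpan by the
ε-negative negative lemma is EXPECTED and
is NOT a kill: it certifies E ≠ ∅ (the item is then held; the deciding path touches it only through
the vacuous direction EnvelopedOfThetaSpan). (v) Any proof of HC for compact
ball-quotient fourfolds by other means ⇒ `superseded`.

NOT DECOMPOSED YET. #5's decomposition IS typed (AlgebraicOrEnvelopedOfSplit: #4 + OrthogonalSplit +
CupProductAlgebraic; a formal
`--split` is not filed because the children already exist as items); the five Literature facts under
the two supports are cone debt for
literature-provers, not items; the split of #4 (OrthogonalEnveloped ⇐ ThetaOrthogonalClassification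
∧ CoreVanishing ∧ HeckeEnvelope, the last
provable once Hecke correspondences of a datum are typed as cycles on X×X); the split of #3 (⇐
SupersingularSeeds ∧ BEK-in-the-piece ∧ ALG,
once integral models / K₀ of the special fibre are typed — SIL's ALG item is the shared child);
CoreVanishing's own tools (rank-down
transporter for Ψ₃-cores, line lefschetz-one-rank-down; irreducibility of r(Ψ_d), Calegari–Gee / Xia
/ Patrikis–Taylor); m = 2 purity
bookkeeping (AMR arXiv:1507.01432); n ≥ 4, odd p, non-compact Picard modular varieties; the
Chow-level shadow (ε = −1 ⟹ L'(½) and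
Li–Liu arithmetic theta, arXiv:2006.06139: homologically trivial cycles in the same packets —
recorded as the reason theta CANNOT produce
the kernel's cohomology classes, not used).

CHEAPEST FALSIFIER. A finite sign computation, no geometry: with the A-packet labels of
Arancibia–Mœglin–Renard for ψ_∞ of ψ = ρ⊠R₂ ⊞ χ₀
on U(4,1) and U(5,0), check (a) η_{A(2,2)}(s_ψ)·∏η_𝟙(s_ψ) admits automorphic members with an ODD
number of δ-places when
ε(½,ρ×χ₀⁻¹) = −1 (else E = ∅ at m = 1 conditionally and the old heart revives), and (b) η_𝟙(s_ψ) on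
U(5,0) gives the SAME parity
(else SupersingularSeeds is dead on arrival: the definite form I does not carry π_f and the basic
locus misses the kernel). Both are
table look-ups (triage r1-3 Panel note 2 gives η_{A(2,2)} = (1,−1,−1,−1,1), η_𝟙 = (1,−1,1,−1,1) ⇒
both products +1 on the ρ⊠R₂ block:
(a) and (b) pass on paper; a refuter should re-derive the tables from AMR). Second cheapest:
Xiao–Zhu Rem. 20 V-generality for the CAP
Satake parameter (done here: t_j = β^{±1}q^{½} ≠ 1).

TWO-LAYER PLAN. OrthogonalEnveloped ⇐ VisibleSpanning (prim H^{n,n} of theta-visible Tate-type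
pieces ⊆ SC ⊔ SCon at level D) →
CoreVanishing (no rational primitive (n,n)-class has a core component) → HeckeEnvelope
(theta-invisible Tate-type pieces are pure and
Hecke-cut; glue: sieve + Hodge–Riemann on pieces). IsotypicMiddleClassesAlgebraic ⇐
SupersingularSeeds → PieceLifting (BEK inside an
algebraically cut pure piece, from the tree fact) → ALG (shared with SupersingularIsotypicLift;
PadicSemiregularLift's P1a/P3a as the
object-level route into it). k ≤ 3 each, depth 1; nothing filed until a crux of layer 1 moves or the
vocabulary (Hecke correspondences as
cycles; integral models) lands.

NUMBERS. BMM Cor. 2 range n ∉ ]p/3, 2p/3[: first excluded middle degrees (p,n) = (4,2), (6,3) = this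
route. Basic locus of U(1,N−1), N odd,
inert p: dimension (N−1)/2 (Vollaard–Wedhorn) = n for N = 2n+1: HALF of dim X = 2n for both m = 1
(surfaces in a fourfold) and m = 2
(threefolds in a sixfold); dim V^{Tate}_{μ*} = C((N−1)/2, ⌊i/2⌋) = C(n,0) = 1 for signature (1, N−1)
(Xiao–Zhu p.4). V-generality
(Rem. 20, Ĝ = GL_{2n+1} with the outer automorphism, V = Std): α_i ≠ α_{2n+2−i} for i ≠ n+1, i.e.
base-change Satake eigenvalues
t_j ≠ 1; CAP: |t_j| = q^{½}. BEK bound p > d + 6: p > 10 (m = 1), p > 12 (m = 2). Arthur sign: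
ε_ψ(s_ψ) = ε(½, ρ×χ₀⁻¹) for
(ρ⊠R₂, χ₀⊠R₁) (b₁ + b₂ odd). Items after rev 11: 13 typed (1 target, 5 cruxes incl. the auto-crux, 6
support, 1 assembly) + 2 informal
cruxes = 15 ≤ 15 (at the cap: the next addition must ride on a drop or a split). Route-file import
cone after rev 11: 5 Literature imports,
88 project modules (was 172), 0 unproved named facts (was 3:
Deligne1974_ker_restrictCompl_eq_iSup_range_complexGysin via GysinKernelProofs;
nonempty_homeomorph_sphere_of_isGluckTwist, isOrientable_iff_isOrientableOver_int via
ComplexPointsOrientation); `closes` is 6 lines.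

SOURCES. BergeronMillsonMoeglin2016Balls (arXiv:1306.1515) Thm 4, 61, 62, 71–72, Prop 80–81;
KudlaMillson1990; GanIchino arXiv:1409.6824 Thm 4.4,
(P2); Mok arXiv:1206.0882; KMSW arXiv:1409.3731; ArancibiaMoeglinRenard arXiv:1507.01432; A. Paul
Proc. AMS 128 (2000) Thm 3.4
(doi:10.1090/s0002-9939-00-05359-4); GanQiuTakeda arXiv:1207.4709; MarshallShin arXiv:1804.05047;
XiaoZhu arXiv:1707.05700;
VollaardWedhorn2011 (Invent. 184); Muller arXiv:2110.00614; HelmTianXiao arXiv:1410.2343;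
BlochEsnaultKerz2014pAdic (arXiv:1203.2776);
CostaSertoz2021; LiLiu arXiv:2006.06139; Lieberman1968; BlasiusRogawski zbl:0828.14012; Deligne2000;
BrosnanFangNiePearlstein2009; crux
workfiles Cruxes/MiddleThetaSpan/{Disproof.lean, KillPatternEpsNegativeCAP.md, TRIAGE-r1-3.md,
Lines/conjugate-dimension-sieve.md, PICKED.md}.

DEFINITION REQUESTS. None filed now. Foreseen (block the informal cruxes): Hecke correspondences of
a UnitaryBallQuotientDatum as cycles on
X × X (for HeckeEnvelope); integral canonical models at hyperspecial primes + basic locus + K₀ of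
the special fibre over the tree's
WittScheme/KZero vocabulary (for SupersingularSeeds / PieceLifting); cohomological representations
A(a,b), Matsushima decomposition,
Arthur parameters (for ThetaOrthogonalClassification).

Novelty: Searches (this pass, 2026-08-16; `lit search`/`--hybrid` service unavailable rc 75 ×3, logged): `lit
galaxy search --star all` ×4
("Tate cycles on some unitary Shimura varieties mod p" → Li–Zhu AFL remarks only; "supersingular
locus of the Shimura variety of GU(1," →
Muller arXiv:2110.00614 (READ pp.1–3: Vollaard–Wedhorn Bruhat–Tits strata = generalized
Deligne–Lusztig varieties of U_{2d+1}(p),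
dimension d); "Cycles on Shimura varieties via geometric Satake" → not in galaxy; "exotic Tate
classes" → 0); `lit galaxy search --star pdf
--mode bm25` "Hodge classes on unitary Shimura varieties that are not spanned by special cycles" (12
hits, none relevant); `lit read
arxiv:1707.05700` (Xiao–Zhu, pp.1–12 READ: §1.1 main theorem (1)–(3), Lemma 2, Def. 19, Rem. 20
V-general = α_i ≠ α_{2n+2−i}, Thm 21 JL
multiplicity); tree reads: Literature/AlgebraicGeometry/Crystalline/BlochEsnaultKerzLifting.lean
(BEK Thm 1.3 as named fact), the whole
route files SupersingularIsotypicLift (LIFT/ENV/ALG) and PadicSemiregularLift (P1a/P3a),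
Cruxes/MiddleThetaSpan/{Disproof.lean F1–F11,
KillPatternEpsNegativeCAP.md, TRIAGE-r1-3.md, Lines/conjugate-dimension-sieve.md, PICKED.md};
`ledger negatives --problem HodgeConjecture`
(2 unrelated: ELineTransport matrix identity, Fermat-K3 multiset). Inherited from rev 0–2: `lit read
arxiv:1306.1515` (BMM pp.3,5,39–42,
53–54), `lit citing arXiv:1306.1515` (31 descendants, none on the middle degree), `lit frontier
HodgeConjecture --since 2020`, 4 galaxy
sweeps, th  [refs: 2110.00614, 1707.05700, 1306.1515, 1410.2343, 1203.2776, 1409.6824, 2006.06139, math/0310162, arxiv:1707.05700, arxiv:1306.1515, VollaardWedhorn2011]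

Barriers (technique_class: theta-lifts, endoscopy, shimura, p-adic-lifting, hecke): - technique_class: theta-lifts, endoscopy, shimura, p-adic-lifting, hecke
- Literature.Barriers.HodgeConjecture.Weil1977_exceptionalHodgeClasses: APPLIES to the shape of TW
(products with divisor classes) — evaded: TW also contains special cycles of codimension n and
cycles ON special cycles, the Lefschetz part is charged to HC one degree down, and the classes
divisors can never reach (the kernel E) are an explicit crux attacked by non-product means (Hecke
envelope + supersingular seeds), never claimed to be products.
- Literature.Barriers.HodgeConjecture.Mumford1968_simpleFourfold_exceptionalHodgeClasses: same
answer; nothing is claimed to be generated in degree 2.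
- Literature.Barriers.HodgeConjecture.hodgeClassesAreAbsoluteFor_abelianVariety: not used in rev 3 —
the sieve conjugates COEFFICIENTS (ringChange σ), never varieties; BallQuotientHodgeAbsolute is
dropped; the one Hodge-theoretic bet left on the proof side is CoreVanishing, stated as such.
- Literature.Barriers.HodgeConjecture.Andre1996_hodgeClassesOnAbelianVarieties_motivated: idem; no
motivated-cycle or abelian-variety input is invoked (ball quotients are not known to have abelian
motives and none is assumed).
- Literature.Barriers.HodgeConjecture.Serre1964_conjugateVarieties_notHomeomorphic: no Betti class
is transported along Aut(ℂ) or to characteristic p: what travels to X̄_p is the de Rham/crystalline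
realization of a piece CUT OUT BY AN ALGEBRAIC CORRESPONDENCE (Hecke), and the return to Betti is (V
⊗ ℂ) ∩

History (route lifecycle, newest last):
- 2026-08-15T19:32:49Z · rev 1: restated MiddleThetaSpan (stmt-HodgeConjecture-14347), HigherBlasiusRogawskiClass (stmt-HodgeConjecture-14349), FourfoldHodge (stmt-HodgeConjecture-14352) — cone repair (rrepair unit 5f6cfd8e): drop imports ShimuraVarieties.SpecialCycleClasses (15 unproved facts via SupportedClassesRationalProofs) and HodgeTheor (planner-rrepair-HodgeConjecture-EndoscopicMidd-5f6cfd8e-0)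
- 2026-08-16T02:19:16Z · AUTO-CRUX: 1 conjecture-grade item(s) promoted to crux (SectorComplement) — refuter vetting / tiering apply (operator:999:1362873)
- 2026-08-16T02:30:13Z · rev 3: restated Assembly (stmt-HodgeConjecture-14354) — ground repair (rground 5f6cfd8e): restate Assembly (stmt-HodgeConjecture-14354 = MiddleThetaSpan → CupProductAlgebraic → ThetaStep → SectorComplement → HodgeCon (planner-rground-HodgeConjecture-EndoscopicMiddl-5f6cfd8e-0)
- 2026-08-16T03:06:00Z · rev 4: dropped BallQuotientHodgeAbsolute, HigherBlasiusRogawskiClass, stmt-HodgeConjecture-13438, stmt-HodgeConjecture-13465 — rev 3a (promote-to-A, step 1/2): drop items not on the revised deciding path — BallQuotientHodgeAbsolute (not load-bearing: the coefficient-conjugation sieve of (planner-promote-HodgeConjecture-EndoscopicMidd-5f6cfd8e-0)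
- 2026-08-16T03:33:43Z · rev 6: restated Assembly (stmt-HodgeConjecture-14073) — rev 3b (promote-to-A, step 3/3): absorb the crux chain on MiddleThetaSpan (sieve is AH-free; C'' repair; triage r1-3 eps-negative GL2-CAP kill pattern => theta (planner-promote-HodgeConjecture-EndoscopicMidd-5f6cfd8e-0)
- 2026-08-16T03:56:50Z · rev 7: restated Assembly (stmt-HodgeConjecture-14583) — rev 3d (promote-to-A, glue.non-crux-hypothesis repair): the deciding theorem is re-supplied with the glue INLINED — hypotheses are now the cruxes IsotypicMiddle (planner-promote-HodgeConjecture-EndoscopicMidd-5f6cfd8e-0)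
- 2026-08-16T03:56:50Z · rev 7: dropped KernelStep, OrientationData — rev 3d (promote-to-A, glue.non-crux-hypothesis repair): the deciding theorem is re-supplied with the glue INLINED — hypotheses are now the cruxes IsotypicMiddle (planner-promote-HodgeConjecture-EndoscopicMidd-5f6cfd8e-0)

sub-problem: HodgeConjecture · status: open · opened planner-plancard-HodgeConjecture-HodgeConject-3ae64d18-g2-0 2026-08-15T19:07:30Z · rev 11 · ledger route-HodgeConjecture-EndoscopicMiddleDegree
GENERATED by the gate from the ledger (D-0016/17). Provers cite these decls: `theorem foo : Summit.HodgeConjecture.HodgeConjecture.Theses.EndoscopicMiddleDegree.<Decl> := …` in Summits/HodgeConjecture/HodgeConjecture/Theorems/<Name>.lean.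
-/

namespace Summit.HodgeConjecture.HodgeConjecture.Theses.EndoscopicMiddleDegree

open scoped BigOperators Topology Manifold Classical MeasureTheory ProbabilityTheory Matrix InnerProductSpace ComplexConjugate ContinuousMap
open Filter Set Function TopologicalSpace MeasureTheory

attribute [summit_statement] _root_.HodgeConjecture

/-- item stmt-HodgeConjecture-14346 · target · rank 0 · open · by planner
why it might fail: = HC in the middle degree of compact arithmetic 4- /6-ball quotients; false iff a non-algebraic rational (2,2)/(3,3)-class exists — after rev 7 the prime suspects are the ε-negative / centrally-vanishing GL₂-CAP Tate classes (theta-orthogonal kernel).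
sources: arXiv:1306.1515, Deligne2000, BrosnanFangNiePearlstein2009
[target] for m ∈ {1,2} (dimension 2n = 2(m+1) ∈ {4,6}) and X carrying a UnitaryBallQuotientDatum: if
every rational Hodge (m,m)-class in H^{2m}(X(ℂ);ℂ) is algebraic then every rational Hodge
(m+1,m+1)-class in the middle degree H^{2m+2} is algebraic (HC propagates one step into the middle;
m = 1: the hypothesis is Lefschetz (1,1); m = 2: it is BMM Cor. 2 at (p,n) = (6,2)). -/
@[route_item "route-HodgeConjecture-EndoscopicMiddleDegree"]
def MiddleDegreeStep : Prop :=
  ∀ (m : ℕ) (X : Literature.AlgebraicGeometry.Motives.SchemeOver ℂ), 1 ≤ m → m ≤ 2 → Nonempty (Literature.AlgebraicGeometry.ShimuraVarieties.UnitaryBallQuotientDatum (2 * (m + 1)) X) → (∀ a : Literature.AlgebraicGeometry.HodgeTheory.complexBetti X (2 * m), Literature.AlgebraicGeometry.HodgeTheory.IsRationalClass a → Literature.AlgebraicGeometry.HodgeTheory.IsOfHodgeType (2 * (m + 1)) X (2 * m) m m a → a ∈ Literature.AlgebraicGeometry.HodgeTheory.algebraicClasses X m) → ∀ c : Literature.AlgebraicGeometry.HodgeTheory.complexBetti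 X (2 * (m + 1)), Literature.AlgebraicGeometry.HodgeTheory.IsRationalClass c → Literature.AlgebraicGeometry.HodgeTheory.IsOfHodgeType (2 * (m + 1)) X (2 * (m + 1)) (m + 1) (m + 1) c → c ∈ Literature.AlgebraicGeometry.HodgeTheory.algebraicClasses X (m + 1)

-- earlier MiddleThetaSpan (stmt-HodgeConjecture-14347, replaced 2026-08-15T19:32:49Z -> stmt-HodgeConjecture-13661): retired by None — ∀ (m : ℕ) (X : Literature.AlgebraicGeometry.Motives.SchemeOver ℂ) (D : Literature.AlgebraicGeometry.ShimuraVarieties.UnitaryBallQuotientDatum (2 * (m + 1)) X), 1 ≤ m → m ≤ 2 → ∀ c : Literature.AlgebraicGeometry.HodgeTheory.complexBetti X (2 * (m + 1)), Literature.Alg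
/-- item stmt-HodgeConjecture-13661 · crux · rank 2 · open · by planner
why it might fail: EXPECTED FALSE at m=1 modulo AMF for non-tempered ψ on U(V): GL₂-CAP ρ⊠R₂⊞χ₀ with ε(½,ρ×χ₀⁻¹)=−1 give rational Tate (2,2)-pieces lifting from no W₄ (GI dichotomy incoherent), outside the span, C′ and C″ (triage r1-3); also R1 at ≥2 non-split places (F10/F11).
sources: arXiv:1306.1515, arXiv:1409.6824, GanIchino2014, arXiv:1409.3731, KalethaEtAl2014, arXiv:1507.01432
[crux] (card B1∘B2, THE HEART) for m ∈ {1,2}, D : UnitaryBallQuotientDatum (2(m+1)) X and c ∈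
H^{2(m+1)}(X(ℂ);ℂ) rational of Hodge type (m+1,m+1): c ∈ SC^{m+1}(D) ⊔ span{s ∪ d : s ∈ SC^m(D), d ∈
algebraicClasses X 1} ⊔ span{a ∪ d : a rational Hodge (m,m), d ∈ algebraicClasses X 1}, SC^k(D) =
the complex span of the classes supported on the special sub-ball quotients c(W), W ⊆ V totally
positive definite of dimension k — BMM Thm 4(2)'s shape SC^{2(a−1)}·H^{1,1} ↠ H^{a×1,a×1}
transported INTO the excluded middle degree a = n = p/2, for rational classes only, with the
Lefschetz part L·Hdg^{n−1,n−1} explicit (expected proof: c = c₀ + L c'; c₀ primitive = discrete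
series A(n,n); rational ⟹ absolute Hodge/Tate ⟹ parameter Ψ'⊞χ₀ ⟹ pole at s=1 ⟹ theta from W₁⊕W₂
(dim 2n−2 + 2) ⟹ ψ_{n−1,n−1}∧ψ_{1,1} classes; H^{1,1} and H^{n−1,n−1} are defined over ℚ for n ≤ 3
by Cor. 62, which is why m ≤ 2). RENDERING (cone repair 2026-08-15): `specialCycleClasses D k` (file
ShimuraVarieties/SpecialCycleClasses) is written out as its definitional unfolding `⨆ (W) (_ :
IsTotallyPositive (conjRingHom D.E) D.H W) (_ : Module.finrank D.E W = k), classesSupportedOn X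
(D.specialSubvariety W) (2 * k)` (`specialCy -/
@[route_item "route-HodgeConjecture-EndoscopicMiddleDegree"]
def MiddleThetaSpan : Prop :=
  ∀ (m : ℕ) (X : Literature.AlgebraicGeometry.Motives.SchemeOver ℂ) (D : Literature.AlgebraicGeometry.ShimuraVarieties.UnitaryBallQuotientDatum (2 * (m + 1)) X), 1 ≤ m → m ≤ 2 → ∀ c : Literature.AlgebraicGeometry.HodgeTheory.complexBetti X (2 * (m + 1)), Literature.AlgebraicGeometry.HodgeTheory.IsRationalClass c → Literature.AlgebraicGeometry.HodgeTheory.IsOfHodgeType (2 * (m + 1)) X (2 * (m + 1)) (m + 1) (m + 1) c → c ∈ (⨆ (W : Submodule D.E (Fin (2 * (m + 1) + 1) → D.E)) (_ : Literature.AlgebraicGeometry.ShimuraVarieties.IsTotallyPositive (Literature.AlgebraicGeometry.ShimuraVarieties.conjRingHom D.E) D.H W) (_ : Module.finrank D.E W = m + 1), Literature.AlgebraicGeometry.HodgeTheory.classesSupportedOn X (D.specialSubvariety W) (2 * (m + 1))) ⊔ Submodule.span ℂ {z : Literature.AlgebraicGeometry.HodgeTheory.complexBetti X (2 * (m + 1))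 | ∃ s ∈ (⨆ (W : Submodule D.E (Fin (2 * (m + 1) + 1) → D.E)) (_ : Literature.AlgebraicGeometry.ShimuraVarieties.IsTotallyPositive (Literature.AlgebraicGeometry.ShimuraVarieties.conjRingHom D.E) D.H W) (_ : Module.finrank D.E W = m), Literature.AlgebraicGeometry.HodgeTheory.classesSupportedOn X (D.specialSubvariety W) (2 * m)), ∃ d ∈ Literature.AlgebraicGeometry.HodgeTheory.algebraicClasses X 1, z = Literature.AlgebraicTopology.SingularHomology.cupProduct (Literature.AlgebraicGeometry.HodgeTheory.two_mul_add_two_mul m 1) s d} ⊔ Submodule.span ℂ {z : Literature.AlgebraicGeometry.HodgeTheory.complexBetti X (2 * (m + 1)) | ∃ a : Literature.AlgebraicGeometry.HodgeTheory.complexBetti X (2 * m), Literature.AlgebraicGeometry.HodgeTheory.IsRationalClass a ∧ Literature.AlgebraicGeometry.HodgeTheory.IsOfHodgeType (2 * (m + 1)) X (2 * m) m m a ∧ ∃ d ∈ Literature.AlgebraicGeometry.HodgeTheory.algebraicClasses X 1, z = Literature.AlgebraicTopology.SingularHomology.cupProduct (Literature.AlgebraicGeometry.HodgeTheory.two_mul_add_two_mul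 m 1) a d}

/-- item stmt-HodgeConjecture-14301 · crux · rank 3 · open · by planner
why it might fail: Only with HC; the ATTACK dies if a_G(π_f) ≠ m_I(π_f) for ε-negative CAP ψ (basic locus under-produces: kernel classes exotic mod p too), if V-generality fails for a relevant π_p, or if ALG is false (phantom pro-K₀ class; Costa–Sertöz-computable).
sources: arXiv:1707.05700, XiaoZhu2017, arXiv:1203.2776, BlochEsnaultKerz2014pAdic, VollaardWedhorn2011, Muller2021
[crux] HARDEST OF THE LIVE LINE (rank 3). For μ with Poincaré duality, m ∈ {1,2}, a datum D on X and
γ ∈ algebraicClasses (X ⊗ X) (2n) whose action P (as in OrthogonalEnveloped) preserves rational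
classes and has purely (n,n) image: every rational c with P c = c is algebraic. LITERALLY the
restriction of SupersingularIsotypicLift.IsotypicClassesAlgebraic (stmt-HodgeConjecture-3048) to
ball-quotient 4- /6-folds in the middle degree (`isotypicMiddle_of_lift : LIFT → this` proved in the
planner's Sketch.lean), strictly weaker, and with its OWN complete attack because here seeds exist
at every inert prime: (S) SupersingularSeeds (informal crux): at an inert hyperspecial v the basic
locus of X̄_v is HALF-dimensional (Vollaard–Wedhorn: closed Bruhat–Tits strata ≅ generalized
Deligne–Lusztig varieties of U_{2n+1}(p) of dimension n) and Xiao–Zhu arXiv:1707.05700 §1.1 (1)–(2)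
give H^{BM}_{2n}(basic) ≅ C(I(ℚ)\I(𝔸_f)/K) ⊗ V^{Tate} with injective cycle class map on V-general
pieces — the CAP Satake parameter (βq^{½}, β⁻¹q^{½}) is V-general (Rem. 20) — so with the
multiplicity comparison a_G(A(n,n)⊗π_f) = m_I(𝟙⊗π_f) the reduction of a theta-invisible Tate-type
piece is SPANNED by Hecke projectio -/
@[route_item "route-HodgeConjecture-EndoscopicMiddleDegree"]
def IsotypicMiddleClassesAlgebraic : Prop :=
  ∀ (μ : Literature.AlgebraicGeometry.HodgeTheory.OrientationFamily), μ.HasPoincareDuality → ∀ (m : ℕ) (X : Literature.AlgebraicGeometry.Motives.SchemeOver ℂ) (D : Literature.AlgebraicGeometry.ShimuraVarieties.UnitaryBallQuotientDatum (2 * (m + 1)) X), 1 ≤ m → m ≤ 2 → ∀ (γ : Literature.AlgebraicGeometry.HodgeTheory.complexBetti (CategoryTheory.MonoidalCategoryStruct.tensorObj X X) (2 * (2 * (m + 1)))), γ ∈ Literature.AlgebraicGeometry.HodgeTheory.algebraicClasses (CategoryTheory.MonoidalCategoryStruct.tensorObj X X) (2 * (m + 1)) → let P : Literature.AlgebraicGeometry.HodgeTheory.complexBetti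 X (2 * (m + 1)) → Literature.AlgebraicGeometry.HodgeTheory.complexBetti X (2 * (m + 1)) := fun β => Literature.AlgebraicGeometry.HodgeTheory.complexGysin μ (Literature.AlgebraicGeometry.Motives.IsSmoothProjective.tensor_holds D.isSmoothProjective D.isSmoothProjective) D.isSmoothProjective (CategoryTheory.CartesianMonoidalCategory.fst X X) (show 2 * (m + 1) + 2 * (2 * (m + 1)) + 2 * (2 * (m + 1)) = 2 * (m + 1) + 2 * (2 * (m + 1) + 2 * (m + 1)) by ring) (Literature.AlgebraicTopology.SingularHomology.cupProduct (rfl : 2 * (m + 1) + 2 * (2 * (m + 1)) = 2 * (m + 1) + 2 * (2 * (m + 1))) (Literature.AlgebraicGeometry.HodgeTheory.complexBetti.map (CategoryTheory.CartesianMonoidalCategory.snd X X) (2 * (m + 1)) β) γ); (∀ β, Literature.AlgebraicGeometry.HodgeTheory.IsRationalClass β → Literature.AlgebraicGeometry.HodgeTheory.IsRationalClass (P β)) → (∀ β, Literature.AlgebraicGeometry.HodgeTheory.IsOfHodgeType (2 * (m + 1)) X (2 * (m + 1)) (m + 1) (m + 1) (P β)) → ∀ c, Literature.AlgebraicGeometry.HodgeTheory.IsRationalClass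 c → P c = c → c ∈ Literature.AlgebraicGeometry.HodgeTheory.algebraicClasses X (m + 1)

/-- item stmt-HodgeConjecture-14300 · crux · rank 4 · open · by planner
why it might fail: One rational (2,2)-class in one CORE piece of a compact U(4,1) quotient (likeliest the even core Ψ₄∋0 ⊞ χ₀; no tool: = failure of Hodge⟹Tate-type for these motives) kills the route proof; at m=2 a non-DS Adams–Johnson member sharing π_f could make the CAP piece impure in H⁶.
sources: arXiv:1306.1515, arXiv:1409.6824, arXiv:1207.4709, arXiv:1507.01432, arXiv:1804.05047, zbl:0828.14012
[crux] THE AUTOMORPHIC HEART, absolute-Hodge-free (rank 4). For μ an orientation family with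
Poincaré duality, m ∈ {1,2}, a datum D and a rational Hodge (n,n)-class e CUP-ORTHOGONAL to the
theta world TW(D) (same three summands as OrthogonalSplit): there is γ ∈ algebraicClasses (X ⊗ X)
(2n) whose correspondence action P β = pr₁₊(pr₂*β ∪ γ) (pr₁₊ = complexGysin μ; the
SupersingularIsotypicLift shape verbatim) preserves rational classes, has purely (n,n) image, and
fixes e. ROUTE PROOF (each step a stub of line conjugate-dimension-sieve or a printed theorem): e ⊥
TW ⟹ e primitive (TW ⊇ L·Hdg^{n-1,n-1}_ℚ); Hecke pieces (Matsushima, BMM Thm 61);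
coefficient-conjugation sieve ⟹ e has components only in Tate-type (all conjugates purely A(n,n)) or
core pieces; for a theta-VISIBLE Tate-type piece (π_f a global theta lift from some 2n-dimensional
W: coherent Gan–Ichino dichotomy data and L(½) ≠ 0 in the CAP case) prim H^{n,n}[π_f] ⊆ (SC ⊔ SCon)
∩ piece by Kudla–Millson + BMM Thm 71 seesaw with K-invariant Schwartz functions (deeper-level
products trace to cycles ON special cycles), so by Hodge–Riemann on the piece e has no component
there; CoreVanishing (BET: cores carry no rational primiti -/
@[route_item "route-HodgeConjecture-EndoscopicMiddleDegree"]
def OrthogonalEnveloped : Prop :=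
  ∀ (μ : Literature.AlgebraicGeometry.HodgeTheory.OrientationFamily), μ.HasPoincareDuality → ∀ (m : ℕ) (X : Literature.AlgebraicGeometry.Motives.SchemeOver ℂ) (D : Literature.AlgebraicGeometry.ShimuraVarieties.UnitaryBallQuotientDatum (2 * (m + 1)) X), 1 ≤ m → m ≤ 2 → ∀ e : Literature.AlgebraicGeometry.HodgeTheory.complexBetti X (2 * (m + 1)), Literature.AlgebraicGeometry.HodgeTheory.IsRationalClass e → Literature.AlgebraicGeometry.HodgeTheory.IsOfHodgeType (2 * (m + 1)) X (2 * (m + 1)) (m + 1) (m + 1) e → (∀ x ∈ ((⨆ (W : Submodule D.E (Fin (2 * (m + 1) + 1) → D.E)) (_ : Literature.AlgebraicGeometry.ShimuraVarieties.IsTotallyPositive (Literature.AlgebraicGeometry.ShimuraVarieties.conjRingHom D.E) D.H W) (_ : Module.finrank D.E W = m + 1), Literature.AlgebraicGeometry.HodgeTheory.classesSupportedOn X (D.specialSubvariety W) (2 * (m + 1))) ⊔ (⨆ (W : Submodule D.E (Fin (2 * (m + 1) + 1) → D.E)) (_ : Literature.AlgebraicGeometry.ShimuraVarieties.IsTotallyPositive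 (Literature.AlgebraicGeometry.ShimuraVarieties.conjRingHom D.E) D.H W) (_ : Module.finrank D.E W = m) (Z : Set X.left) (_ : IsClosed Z) (_ : Z ⊆ D.specialSubvariety W) (_ : ∀ z ∈ Z, ((m + 1 : ℕ) : ℕ∞) ≤ Order.coheight z), Literature.AlgebraicGeometry.HodgeTheory.classesSupportedOn X Z (2 * (m + 1))) ⊔ Submodule.span ℂ {z : Literature.AlgebraicGeometry.HodgeTheory.complexBetti X (2 * (m + 1)) | ∃ a : Literature.AlgebraicGeometry.HodgeTheory.complexBetti X (2 * m), Literature.AlgebraicGeometry.HodgeTheory.IsRationalClass a ∧ Literature.AlgebraicGeometry.HodgeTheory.IsOfHodgeType (2 * (m + 1)) X (2 * m) m m a ∧ ∃ d ∈ Literature.AlgebraicGeometry.HodgeTheory.algebraicClasses X 1, z = Literature.AlgebraicTopology.SingularHomology.cupProduct (Literature.AlgebraicGeometry.HodgeTheory.two_mul_add_two_mul m 1) a d}), Literature.AlgebraicTopology.SingularHomology.cupProduct (Literature.AlgebraicGeometry.HodgeTheory.two_mul_add_two_mul (m + 1) (m + 1)) e x = 0) → ∃ γ ∈ Literature.AlgebraicGeometry.HodgeTheory.algebraicClasses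 (CategoryTheory.MonoidalCategoryStruct.tensorObj X X) (2 * (m + 1)), let P : Literature.AlgebraicGeometry.HodgeTheory.complexBetti X (2 * (m + 1)) → Literature.AlgebraicGeometry.HodgeTheory.complexBetti X (2 * (m + 1)) := fun β => Literature.AlgebraicGeometry.HodgeTheory.complexGysin μ (Literature.AlgebraicGeometry.Motives.IsSmoothProjective.tensor_holds D.isSmoothProjective D.isSmoothProjective) D.isSmoothProjective (CategoryTheory.CartesianMonoidalCategory.fst X X) (show 2 * (m + 1) + 2 * (2 * (m + 1)) + 2 * (2 * (m + 1)) = 2 * (m + 1) + 2 * (2 * (m + 1) + 2 * (m + 1)) by ring) (Literature.AlgebraicTopology.SingularHomology.cupProduct (rfl : 2 * (m + 1) + 2 * (2 * (m + 1)) = 2 * (m + 1) + 2 * (2 * (m + 1))) (Literature.AlgebraicGeometry.HodgeTheory.complexBetti.map (CategoryTheory.CartesianMonoidalCategory.snd X X) (2 * (m + 1)) β) γ); (∀ β, Literature.AlgebraicGeometry.HodgeTheory.IsRationalClass β → Literature.AlgebraicGeometry.HodgeTheory.IsRationalClass (P β)) ∧ (∀ β, Literature.AlgebraicGeometry.HodgeTheory.IsOfHodgeType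 (2 * (m + 1)) X (2 * (m + 1)) (m + 1) (m + 1) (P β)) ∧ P e = e

/-- item stmt-HodgeConjecture-14943 · crux · rank 5 · open · by planner
why it might fail: Only with HC on the sector: a rational (2,2)-class on a compact U(4,1) quotient neither theta-algebraic nor inside a pure Hecke-cut piece (likeliest an even core Ψ₄∋0 ⊞ χ₀) kills the route proof; ¬item itself = ¬HC (Disproof F1). Provability: L–XL Hodge-theory facts under the supports.
sources: arXiv:1306.1515, arXiv:1409.6824, arXiv:1507.01432, VoisinHodgeI2002, VoisinHodgeII2003, BrosnanFangNiePearlstein2009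
[crux] THE DICHOTOMY (rank 5; deciding-path form of OrthogonalEnveloped; planner route-repair rev
11). For m ∈ {1,2}, X with a datum D (dim 2n = 2(m+1)) on which every rational Hodge (m,m)-class is
algebraic: every rational Hodge (n,n)-class c lies in algebraicClasses X n ⊔ span_ℂ{e : e rational
and, for SOME orientation family μ with Poincaré duality and SOME γ ∈ algebraicClasses (X ⊗ X) (2n),
the correspondence action P β = pr₁₊(pr₂*β ∪ γ) (pr₁₊ = complexGysin μ; the shape of
IsotypicMiddleClassesAlgebraic / OrthogonalEnveloped verbatim) preserves rational classes, has
purely (n,n) image and fixes e}. ROUTE PROOF = the support AlgebraicOrEnvelopedOfSplit (proved in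
the planner's SketchGlue.lean, rc 0): OrthogonalSplit puts c in TW(D) + span(theta-orthogonal
rational Hodge classes); TW(D) ≤ algebraicClasses (special cycles and cycles-on-special-cycles by
classesSupportedOn_le_supportedClasses with the datum's codimension fields, the Lefschetz summand by
the hypothesis + CupProductAlgebraic); each theta-orthogonal class is enveloped by
OrthogonalEnveloped at the complex orientation family (Motives.ComplexPoints.isOrientableOver +
OrientationFamily.hasPoincareDuality, Literature the -/
@[route_item "route-HodgeConjecture-EndoscopicMiddleDegree"]
def AlgebraicOrEnveloped : Prop :=
  ∀ (m : ℕ) (X : Literature.AlgebraicGeometry.Motives.SchemeOver ℂ) (D : Literature.AlgebraicGeometry.ShimuraVarieties.UnitaryBallQuotientDatum (2 * (m + 1)) X), 1 ≤ m → m ≤ 2 → (∀ a : Literature.AlgebraicGeometry.HodgeTheory.complexBetti X (2 * m), Literature.AlgebraicGeometry.HodgeTheory.IsRationalClass a → Literature.AlgebraicGeometry.HodgeTheory.IsOfHodgeType (2 * (m + 1)) X (2 * m) m m a → a ∈ Literature.AlgebraicGeometry.HodgeTheory.algebraicClasses X m) → ∀ c : Literature.AlgebraicGeometry.HodgeTheory.complexBetti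 X (2 * (m + 1)), Literature.AlgebraicGeometry.HodgeTheory.IsRationalClass c → Literature.AlgebraicGeometry.HodgeTheory.IsOfHodgeType (2 * (m + 1)) X (2 * (m + 1)) (m + 1) (m + 1) c → c ∈ Literature.AlgebraicGeometry.HodgeTheory.algebraicClasses X (m + 1) ⊔ Submodule.span ℂ {e : Literature.AlgebraicGeometry.HodgeTheory.complexBetti X (2 * (m + 1)) | Literature.AlgebraicGeometry.HodgeTheory.IsRationalClass e ∧ ∃ μ : Literature.AlgebraicGeometry.HodgeTheory.OrientationFamily, μ.HasPoincareDuality ∧ ∃ γ ∈ Literature.AlgebraicGeometry.HodgeTheory.algebraicClasses (CategoryTheory.MonoidalCategoryStruct.tensorObj X X) (2 * (m + 1)), let P : Literature.AlgebraicGeometry.HodgeTheory.complexBetti X (2 * (m + 1)) → Literature.AlgebraicGeometry.HodgeTheory.complexBetti X (2 * (m + 1)) := fun β => Literature.AlgebraicGeometry.HodgeTheory.complexGysin μ (Literature.AlgebraicGeometry.Motives.IsSmoothProjective.tensor_holds D.isSmoothProjective D.isSmoothProjective) D.isSmoothProjective (CategoryTheory.CartesianMonoidalCategory.fst X X) (show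 2 * (m + 1) + 2 * (2 * (m + 1)) + 2 * (2 * (m + 1)) = 2 * (m + 1) + 2 * (2 * (m + 1) + 2 * (m + 1)) by ring) (Literature.AlgebraicTopology.SingularHomology.cupProduct (rfl : 2 * (m + 1) + 2 * (2 * (m + 1)) = 2 * (m + 1) + 2 * (2 * (m + 1))) (Literature.AlgebraicGeometry.HodgeTheory.complexBetti.map (CategoryTheory.CartesianMonoidalCategory.snd X X) (2 * (m + 1)) β) γ); (∀ β, Literature.AlgebraicGeometry.HodgeTheory.IsRationalClass β → Literature.AlgebraicGeometry.HodgeTheory.IsRationalClass (P β)) ∧ (∀ β, Literature.AlgebraicGeometry.HodgeTheory.IsOfHodgeType (2 * (m + 1)) X (2 * (m + 1)) (m + 1) (m + 1) (P β)) ∧ P e = e}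

/-- item stmt-HodgeConjecture-14353 · crux (kind.auto-crux: conjecture-grade) · rank 9 · open · by planner
why it might fail: auto-crux (conjecture-grade): HC off the sector — all other varieties, odd-dimensional and ≥8-dimensional ball quotients, the other middle-third degrees; declared, not claimed; false iff HC fails off-sector.
sources: Deligne2000, BrosnanFangNiePearlstein2009
[support] SECTOR FRAME (bookkeeping, NOT claimed; D-0027 §2.1 / D-0019 frame #1 'X → Statement', as
in routes KugaSatakeSaturation, NodalThetaWeil, SiuRepresentability): MiddleDegreeStep →
HodgeConjecture. Implied by the Hodge conjecture itself, hence irrefutable short of ¬HC; filed only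
so that `closes` and the Assembly conclude `_root_.HodgeConjecture`. Its honest content — HC off the
sector (all other varieties, odd-dimensional and ≥ 8-dimensional ball quotients, the other
middle-third degrees) — is an open problem, recorded, not attacked. Refuters: skip; provers: nothing
to do unless HC is otherwise settled. [difficulty: open-problem] -/
@[route_item "route-HodgeConjecture-EndoscopicMiddleDegree"]
def SectorComplement : Prop :=
  MiddleDegreeStep → _root_.HodgeConjecture

-- item stmt-HodgeConjecture-14613 · support · rank 5 · open · by planner — informal only, no Lean statement yet:
--   [crux] (rank 5, INFORMAL until cohomological representations A(a,b) of U(p,1), the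
--   Matsushima/Hecke-isotypic decomposition of H^k(X(ℂ);ℂ) for a UnitaryBallQuotientDatum and Arthur
--   parameters are typed; decl name ThetaOrthogonalClassification reserved.) THE AUTOMORPHIC CONTENT OF
--   OrthogonalEnveloped, sentence by sentence. X with datum D (dim 2n ∈ {4,6}), TW(D) the theta world of
--   OrthogonalSplit; write H^{2n}(X,ℚ) = ⊕_N N over ℚ-isotypic pieces of the classical Hecke algebra
--   ℋ(Γ, U(V)(F)) (N ⊗ ℂ = ⊕_σ M[σπ_f]). Then: (1) SIEVE (AH-free; stub_sieve of line
--   conjugate-dimension-sieve, provable now)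

-- item stmt-HodgeConjecture-14615 · support · rank 6 · open · by planner — informal only, no Lean statement yet:
--   [crux] (rank 6, INFORMAL until integral canonical models at hyperspecial primes, the basic locus and
--   K₀ / Chow of the special fibre are typed over the tree's WittScheme / KZero vocabulary; decl name
--   SupersingularSeeds reserved.) THE SEEDS FOR IsotypicMiddleClassesAlgebraic. X with datum D (dim 2n ∈
--   {4,6}, G = U(V)), N ⊂ H^{2n}(X,ℚ) a theta-INVISIBLE TATE-TYPE ℚ-Hecke piece (e.g. the ε-negative
--   GL₂-CAP pieces of ThetaOrthogonalClassification (5)), v a place of F with F_v = ℚ_p inert in E, p >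
--   2, K_v hyperspecial (infinitely many). CLAIM: in the ℓ-adic cohomology of the geometric special
--   fibre X

-- earlier FourfoldHodge (stmt-HodgeConjecture-14352, replaced 2026-08-15T19:32:49Z -> stmt-HodgeConjecture-13663): retired by None — MiddleDegreeStep → (∀ X : Literature.AlgebraicGeometry.Motives.SchemeOver ℂ, Literature.AlgebraicGeometry.Motives.IsSmoothProjective 4 X → ∀ c : Literature.AlgebraicGeometry.HodgeTheory.complexBetti X (2 * 1), Literature.AlgebraicGeometry.HodgeTheory.IsRationalClass c 
/-- item stmt-HodgeConjecture-13663 · support · rank 9 · closed · proved by Summit.HodgeConjecture.HodgeConjecture.Theorems.fourfoldHodge_proof @ d99e6b8a9f30 (prover) · by planner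
sources: VoisinHodgeI2002, arXiv:1306.1515, Deligne2000, KerrPearlstein2011
[support] CALIBRATION, proved sorry-free in the repair planner's Sketch.lean (`fourfoldHodge_holds`,
2026-08-15): MiddleDegreeStep plus the classical facts as BINDERS — Lefschetz (1,1) on fourfolds;
the hard-Lefschetz REDUCTION on fourfolds (for 4 < 2p, HC in codimension 4−p ⟹ HC in codimension p:
Voisin I Thm 6.25 + Rem 6.27 + §7.1.2, the conclusion of
`HardLefschetzNFold.mem_algebraicClasses_of_lt`, same shape as the shared item
HardLefschetzReduction at n = 4); Hodge model existence — give `HodgeConjectureFor 4 X` for every X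
carrying a UnitaryBallQuotientDatum 4 X: the Hodge conjecture for compact arithmetic ball-quotient
FOURFOLDS of simple unitary type (degrees 0: tree `hodgeConjectureFor_codim_zero`; 2: Lefschetz; 6,
8, >8: the reduction; 4: the target at m = 1). RENDERING (cone repair 2026-08-15): the former binder
`Nonempty (HardLefschetzNFold 4 X)` (file HardLefschetzNFold → HodgeTypeDimension →
HodgeFiltrationModels, unproved fact hodgePQ_independent_of_hodgeModel in the import cone) is
replaced by the reduction it was used for. [difficulty: provable-now] -/
@[route_item "route-HodgeConjecture-EndoscopicMiddleDegree"]
def FourfoldHodge : Prop :=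
  MiddleDegreeStep → (∀ X : Literature.AlgebraicGeometry.Motives.SchemeOver ℂ, Literature.AlgebraicGeometry.Motives.IsSmoothProjective 4 X → ∀ c : Literature.AlgebraicGeometry.HodgeTheory.complexBetti X (2 * 1), Literature.AlgebraicGeometry.HodgeTheory.IsRationalClass c → Literature.AlgebraicGeometry.HodgeTheory.IsOfHodgeType 4 X (2 * 1) 1 1 c → c ∈ Literature.AlgebraicGeometry.HodgeTheory.algebraicClasses X 1) → (∀ X : Literature.AlgebraicGeometry.Motives.SchemeOver ℂ, Literature.AlgebraicGeometry.Motives.IsSmoothProjective 4 X → ∀ p : ℕ, 4 < 2 * p → (∀ a : Literature.AlgebraicGeometry.HodgeTheory.complexBetti X (2 * (4 - p)), Literature.AlgebraicGeometry.HodgeTheory.IsRationalClass a → Literature.AlgebraicGeometry.HodgeTheory.IsOfHodgeType 4 X (2 * (4 - p)) (4 - p) (4 - p) a → a ∈ Literature.AlgebraicGeometry.HodgeTheory.algebraicClasses X (4 - p)) → ∀ c : Literature.AlgebraicGeometry.HodgeTheory.complexBetti X (2 * p), Literature.AlgebraicGeometry.HodgeTheory.IsRationalClass c → Literature.AlgebraicGeometry.HodgeTheory.IsOfHodgeType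 4 X (2 * p) p p c → c ∈ Literature.AlgebraicGeometry.HodgeTheory.algebraicClasses X p) → (∀ X : Literature.AlgebraicGeometry.Motives.SchemeOver ℂ, Literature.AlgebraicGeometry.Motives.IsSmoothProjective 4 X → Nonempty (Literature.AlgebraicGeometry.HodgeTheory.HodgeModel 4 X)) → ∀ X : Literature.AlgebraicGeometry.Motives.SchemeOver ℂ, Nonempty (Literature.AlgebraicGeometry.ShimuraVarieties.UnitaryBallQuotientDatum 4 X) → Literature.AlgebraicGeometry.HodgeTheory.HodgeConjectureFor 4 X

/-- item stmt-HodgeConjecture-14299 · support · rank 9 · closed · proved by Summit.HodgeConjecture.HodgeConjecture.Theorems.orthogonalSplit_proof @ 7fcdc8d6ecf1 (prover) · by planner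
sources: VoisinHodgeI2002, BrosnanFangNiePearlstein2009, arXiv:1306.1515
[support] ORTHOGONAL SPLIT (pure Hodge theory). For m ∈ {1,2}, a datum D on X (dim 2n, n = m+1) and
the THETA WORLD TW(D) := SCⁿ(D) ⊔ {classes of codimension-n closed subsets lying on the
codimension-m special cycles c(W), dim_E W = m} ⊔ span{a ∪ d : a ∈ Hdg^{m,m}_ℚ, d ∈ algebraicClasses
X 1} (= the R1-safe repaired span C″ of Disproof F3, `SC ⊔ SConSpecial ⊔ Lefschetz`): every rational
Hodge (n,n)-class lies in TW(D) + span_ℂ{e : e rational Hodge (n,n) with e ∪ x = 0 in H^{4n} for all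
x ∈ TW(D)}. Proof on paper: TW is spanned by rational Hodge (n,n)-classes (cycle classes; products
of Hodge classes) and CONTAINS every non-primitive rational Hodge class L ∪ a (a ∈ Hdg^{n-1,n-1}_ℚ,
ℓ = an ample divisor class), so TW_ℚ = (TW_ℚ ∩ Prim) ⊕ L·Hdg^{n-1,n-1}_ℚ; the cup form is definite
on real primitive (n,n)-classes and non-degenerate on L·Hdg^{n-1,n-1}_ℚ (Hodge–Riemann + Lefschetz
decomposition over ℚ), hence non-degenerate on TW_ℚ, hence Hdg_ℚ = TW_ℚ ⊕ TW_ℚ^⊥. Lean cost: hard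
Lefschetz / Hodge–Riemann on the tree's carriers (HardLefschetzNFold, HodgeIndexPrimitive*,
hodgeClasses_cupPairing_nondegenerate) + 'supported classes in degree 2·codim are rational of type
(k,k)'. [deps: none] [d -/
@[route_item "route-HodgeConjecture-EndoscopicMiddleDegree"]
def OrthogonalSplit : Prop :=
  ∀ (m : ℕ) (X : Literature.AlgebraicGeometry.Motives.SchemeOver ℂ) (D : Literature.AlgebraicGeometry.ShimuraVarieties.UnitaryBallQuotientDatum (2 * (m + 1)) X), 1 ≤ m → m ≤ 2 → ∀ c : Literature.AlgebraicGeometry.HodgeTheory.complexBetti X (2 * (m + 1)), Literature.AlgebraicGeometry.HodgeTheory.IsRationalClass c → Literature.AlgebraicGeometry.HodgeTheory.IsOfHodgeType (2 * (m + 1)) X (2 * (m + 1)) (m + 1) (m + 1) c → c ∈ ((⨆ (W : Submodule D.E (Fin (2 * (m + 1) + 1) → D.E)) (_ : Literature.AlgebraicGeometry.ShimuraVarieties.IsTotallyPositive (Literature.AlgebraicGeometry.ShimuraVarieties.conjRingHom D.E) D.H W) (_ : Module.finrank D.E W = m + 1), Literature.AlgebraicGeometry.HodgeTheory.classesSupportedOn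 X (D.specialSubvariety W) (2 * (m + 1))) ⊔ (⨆ (W : Submodule D.E (Fin (2 * (m + 1) + 1) → D.E)) (_ : Literature.AlgebraicGeometry.ShimuraVarieties.IsTotallyPositive (Literature.AlgebraicGeometry.ShimuraVarieties.conjRingHom D.E) D.H W) (_ : Module.finrank D.E W = m) (Z : Set X.left) (_ : IsClosed Z) (_ : Z ⊆ D.specialSubvariety W) (_ : ∀ z ∈ Z, ((m + 1 : ℕ) : ℕ∞) ≤ Order.coheight z), Literature.AlgebraicGeometry.HodgeTheory.classesSupportedOn X Z (2 * (m + 1))) ⊔ Submodule.span ℂ {z : Literature.AlgebraicGeometry.HodgeTheory.complexBetti X (2 * (m + 1)) | ∃ a : Literature.AlgebraicGeometry.HodgeTheory.complexBetti X (2 * m), Literature.AlgebraicGeometry.HodgeTheory.IsRationalClass a ∧ Literature.AlgebraicGeometry.HodgeTheory.IsOfHodgeType (2 * (m + 1)) X (2 * m) m m a ∧ ∃ d ∈ Literature.AlgebraicGeometry.HodgeTheory.algebraicClasses X 1, z = Literature.AlgebraicTopology.SingularHomology.cupProduct (Literature.AlgebraicGeometry.HodgeTheory.two_mul_add_two_mul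 m 1) a d}) ⊔ Submodule.span ℂ {e : Literature.AlgebraicGeometry.HodgeTheory.complexBetti X (2 * (m + 1)) | Literature.AlgebraicGeometry.HodgeTheory.IsRationalClass e ∧ Literature.AlgebraicGeometry.HodgeTheory.IsOfHodgeType (2 * (m + 1)) X (2 * (m + 1)) (m + 1) (m + 1) e ∧ (∀ x ∈ ((⨆ (W : Submodule D.E (Fin (2 * (m + 1) + 1) → D.E)) (_ : Literature.AlgebraicGeometry.ShimuraVarieties.IsTotallyPositive (Literature.AlgebraicGeometry.ShimuraVarieties.conjRingHom D.E) D.H W) (_ : Module.finrank D.E W = m + 1), Literature.AlgebraicGeometry.HodgeTheory.classesSupportedOn X (D.specialSubvariety W) (2 * (m + 1))) ⊔ (⨆ (W : Submodule D.E (Fin (2 * (m + 1) + 1) → D.E)) (_ : Literature.AlgebraicGeometry.ShimuraVarieties.IsTotallyPositive (Literature.AlgebraicGeometry.ShimuraVarieties.conjRingHom D.E) D.H W) (_ : Module.finrank D.E W = m) (Z : Set X.left) (_ : IsClosed Z) (_ : Z ⊆ D.specialSubvariety W) (_ : ∀ z ∈ Z, ((m + 1 : ℕ) : ℕ∞) ≤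 Order.coheight z), Literature.AlgebraicGeometry.HodgeTheory.classesSupportedOn X Z (2 * (m + 1))) ⊔ Submodule.span ℂ {z : Literature.AlgebraicGeometry.HodgeTheory.complexBetti X (2 * (m + 1)) | ∃ a : Literature.AlgebraicGeometry.HodgeTheory.complexBetti X (2 * m), Literature.AlgebraicGeometry.HodgeTheory.IsRationalClass a ∧ Literature.AlgebraicGeometry.HodgeTheory.IsOfHodgeType (2 * (m + 1)) X (2 * m) m m a ∧ ∃ d ∈ Literature.AlgebraicGeometry.HodgeTheory.algebraicClasses X 1, z = Literature.AlgebraicTopology.SingularHomology.cupProduct (Literature.AlgebraicGeometry.HodgeTheory.two_mul_add_two_mul m 1) a d}), Literature.AlgebraicTopology.SingularHomology.cupProduct (Literature.AlgebraicGeometry.HodgeTheory.two_mul_add_two_mul (m + 1) (m + 1)) e x = 0)}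

/-- item stmt-HodgeConjecture-14350 · support · rank 9 · closed · proved by Summit.HodgeConjecture.HodgeConjecture.Theorems.endoscopicMiddleDegree_cupProductAlgebraic_proof (prover) · by planner
sources: VoisinHodgeII2003, Fulton1998
[support] KNOWN (Voisin II Prop. 9.20; Fulton §19.2 + moving lemma §11.4): on a smooth projective
X/ℂ, cup products of algebraic classes are algebraic, N^l H^{2l} ∪ N^k H^{2k} ⊆ N^{l+k} H^{2(l+k)};
same text as stmt-HodgeConjecture-2324 (the tree has the reduction
`cupProduct_mem_algebraicClasses_of_moving`; what remains is its moving hypothesis). [difficulty: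
provable-now] -/
@[route_item "route-HodgeConjecture-EndoscopicMiddleDegree"]
def CupProductAlgebraic : Prop :=
  ∀ ⦃n : ℕ⦄ ⦃X : Literature.AlgebraicGeometry.Motives.SchemeOver ℂ⦄, Literature.AlgebraicGeometry.Motives.IsSmoothProjective n X → ∀ (l k : ℕ) (a : Literature.AlgebraicGeometry.HodgeTheory.complexBetti X (2 * l)) (b : Literature.AlgebraicGeometry.HodgeTheory.complexBetti X (2 * k)), a ∈ Literature.AlgebraicGeometry.HodgeTheory.algebraicClasses X l → b ∈ Literature.AlgebraicGeometry.HodgeTheory.algebraicClasses X k → Literature.AlgebraicTopology.SingularHomology.cupProduct (Literature.AlgebraicGeometry.HodgeTheory.two_mul_add_two_mul l k) a b ∈ Literature.AlgebraicGeometry.HodgeTheory.algebraicClasses X (l + k)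

/-- item stmt-HodgeConjecture-14351 · support · rank 9 · closed · proved by Summit.HodgeConjecture.HodgeConjecture.Theorems.thetaStep_proof @ 074fd9a481a7 (prover) · by planner
sources: arXiv:1306.1515, VoisinHodgeII2003
[support] GLUE, proved sorry-free in the planner's Sketch.lean (`thetaStep_holds`):
CupProductAlgebraic → MiddleThetaSpan → MiddleDegreeStep (special cycle classes are algebraic,
`specialCycleClasses_le_algebraicClasses`; the two spans are products of algebraic classes;
`sup_le`). [difficulty: provable-now] -/
@[route_item "route-HodgeConjecture-EndoscopicMiddleDegree"]
def ThetaStep : Prop :=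
  CupProductAlgebraic → MiddleThetaSpan → MiddleDegreeStep

/-- item stmt-HodgeConjecture-14732 · support · rank 9 · closed · proved by Summit.HodgeConjecture.HodgeConjecture.Theorems.endoscopicMiddleDegree_envelopedOfThetaSpan_proof @ 461c113fa3fd (prover) · by planner
[support] GLUE (route-repair rev 10, unused-crux): the legacy heart MiddleThetaSpan feeds the
deciding theorem's hypothesis h₂ = OrthogonalEnveloped. Content: if the theta span SC^{m+1} ⊔
SC^m·N¹ ⊔ Hdg^{m,m}_ℚ·N¹ exhausts the rational Hodge (m+1,m+1)-classes, the theta-orthogonal kernel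
E(D) is ZERO — SC^m·N¹ ≤ Hdg^{m,m}_ℚ·N¹ (landed
Negative/TwoSummands.spanCup_sc_le_spanCup_ratHodge), so a rational Hodge (n,n)-class e
cup-orthogonal to the theta world TW(D) is orthogonal to the whole span containing it, e ∪ e = 0 and
e ⊥ Hdg^{m,m}_ℚ·N¹, hence e = 0 by hodgeClass_eq_zero_of_cup_orthogonal
(Theorems/EndoscopicMiddleDegreeOrthogonalSplit: Lefschetz step + perfect pairing (6.1) +
Hodge–Riemann anisotropy, modulo the Kähler-package fact hardLefschetz_hodgeRiemann) — and the zero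
class is enveloped by the zero correspondence γ = 0 (P = 0 preserves rational classes,
IsRationalClass.zero, and has (n,n) image, IsOfHodgeType.zero; `envelopedOfThetaSpan_of_kernelZero :
KernelZeroOfThetaSpan → EnvelopedOfThetaSpan` PROVED in the planner's Sketch.lean, rc 0, 0 sorries).
Role: records the dichotomy the rev-7 line rests on (theta spans ⟺ E = 0 ⟹ envelope vacuous) and
connects the rank-2 crux — -/
@[route_item "route-HodgeConjecture-EndoscopicMiddleDegree"]
def EnvelopedOfThetaSpan : Prop :=
  MiddleThetaSpan → OrthogonalEnveloped

/-- item stmt-HodgeConjecture-14944 · support · rank 9 · closed · proved by Summit.HodgeConjecture.HodgeConjecture.Theorems.algebraicOrEnvelopedOfSplit_proof @ 5f2ce66fd612 (prover) · by planner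
[support] GLUE (rev 11): CupProductAlgebraic → OrthogonalSplit → OrthogonalEnveloped →
AlgebraicOrEnveloped — the rev-7 inlined glue moved out of `closes` so that the deciding theorem is
crux-only. Proof (planner's SketchGlue.lean `algebraicOrEnvelopedOfSplit_proof`, rc 0, 0 sorries,
attached as evidence): fix the complex orientation family μ₀ := fun h ↦ Classical.choice
(Motives.ComplexPoints.isOrientableOver ℂ h) with OrientationFamily.hasPoincareDuality μ₀ (imports
Literature.AlgebraicGeometry.HodgeTheory.GysinKernelProofs +
Literature.AlgebraicGeometry.Motives.ComplexPointsOrientation — fine under Theorems/, deliberately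
kept out of the route file); bound OrthogonalSplit's right-hand side: SCⁿ(D) and SCon by
classesSupportedOn_le_supportedClasses (D.isClosed_specialSubvariety,
D.le_coheight_of_mem_specialSubvariety), the Lefschetz summand span{a ∪ d} by the degree-2m
hypothesis and CupProductAlgebraic, and span{e rational Hodge ⊥ TW(D)} ≤ span{enveloped} by
Submodule.span_mono with OrthogonalEnveloped μ₀. [deps: CupProductAlgebraic, OrthogonalSplit,
OrthogonalEnveloped, AlgebraicOrEnveloped] [difficulty: provable-now] -/
@[route_item "route-HodgeConjecture-EndoscopicMiddleDegree"]
def AlgebraicOrEnvelopedOfSplit : Prop :=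
  CupProductAlgebraic → OrthogonalSplit → OrthogonalEnveloped → AlgebraicOrEnveloped

-- earlier Assembly (stmt-HodgeConjecture-14073, replaced 2026-08-16T03:33:43Z -> stmt-HodgeConjecture-14583): retired by None — MiddleThetaSpan → CupProductAlgebraic → SectorComplement → _root_.HodgeConjecture
-- earlier Assembly (stmt-HodgeConjecture-14354, replaced 2026-08-16T02:30:13Z -> stmt-HodgeConjecture-14073): retired by None — MiddleThetaSpan → CupProductAlgebraic → ThetaStep → SectorComplement → _root_.HodgeConjecture
-- earlier Assembly (stmt-HodgeConjecture-14583, replaced 2026-08-16T03:56:50Z -> stmt-HodgeConjecture-14571): retired by None — IsotypicMiddleClassesAlgebraic → OrthogonalEnveloped → OrthogonalSplit → OrientationData → CupProductAlgebraic → SectorComplement → _root_.HodgeConjecture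
/-- item stmt-HodgeConjecture-14571 · assembly · rank 1 · closed · proved by Summit.HodgeConjecture.HodgeConjecture.Theorems.endoscopicMiddleDegree_assembly_proof @ fb5d3ae678ca (prover) · by planner
sources: arXiv:1306.1515, Deligne2000
[assembly] IsotypicMiddleClassesAlgebraic → OrthogonalEnveloped → OrthogonalSplit →
CupProductAlgebraic → SectorComplement → HodgeConjecture: the two cruxes of the revised line, the
two still-unproved supports (Hodge-theoretic orthogonal split; cup products of algebraic classes)
and the declared, not-claimed sector frame decide the summit. Exactly the type of the rev-7 deciding
theorem `closes` minus nothing: NOT a propositional tautology (the content is the inlined glue —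
special cycles and cycles-on-special-cycles are algebraic by classesSupportedOn_le_supportedClasses
with the datum's codimension fields, the Lefschetz summand by the target's hypothesis, the kernel by
envelope + lift with an internally constructed orientation family; `assembly''_holds := closes2` in
the planner's Sketch2.lean, rc 0). Provers: closing this item = re-proving `closes`'s body; do the
supports first. -/
@[route_item "route-HodgeConjecture-EndoscopicMiddleDegree"]
def Assembly : Prop :=
  IsotypicMiddleClassesAlgebraic → OrthogonalEnveloped → OrthogonalSplit → CupProductAlgebraic → SectorComplement → _root_.HodgeConjecture

-- records of items no longer active in this route (dropped / restated):
-- earlier HigherBlasiusRogawskiClass (stmt-HodgeConjecture-14349, replaced 2026-08-15T19:32:49Z -> stmt-HodgeConjecture-13662): retired by None — ∃ (X : Literature.AlgebraicGeometry.Motives.SchemeOver ℂ) (D : Literature.AlgebraicGeometry.ShimuraVarieties.UnitaryBallQuotientDatum 5 X) (c : Literature.AlgebraicGeometry.HodgeTheory.complexBetti X (2 * 2)), Literature.AlgebraicGeometry.HodgeTheory.IsRat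

/-! D-0027 §2.1 — DECIDING THEOREM (planner-authored via `route open/edit --closes-file`; by planner-rbadge-HodgeConjecture-EndoscopicMiddl-5f6cfd8e-g2-0 2026-08-16T06:49:36Z):
its hypotheses are this route's items and its conclusion the sub-problem Statement (glue_lint), and it elaborates with this file. -/

@[closes "route-HodgeConjecture-EndoscopicMiddleDegree"] theorem closes (h₁ : IsotypicMiddleClassesAlgebraic) (h₂ : AlgebraicOrEnveloped) (hS : SectorComplement) :
    _root_.HodgeConjecture := by
  refine hS fun m X hm1 hm2 hD hlow c hc hH ↦ ?_
  obtain ⟨D⟩ := hD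
  -- the dichotomy (crux AlgebraicOrEnveloped): `c` is algebraic modulo rational classes fixed by an algebraic
  -- self-correspondence with purely (n,n) image (each generator carries its orientation family and its γ);
  -- such classes are algebraic (crux IsotypicMiddleClassesAlgebraic); SectorComplement carries the sector to the summit.
  refine (sup_le le_rfl ?_ : _ ≤ Literature.AlgebraicGeometry.HodgeTheory.algebraicClasses X (m + 1)) (h₂ m X D hm1 hm2 hlow c hc hH)
  refine Submodule.span_le.2 ?_
  rintro e ⟨he, μ, hμ, γ, hγ, hrat, hhodge, hfix⟩
  exact h₁ μ hμ m X D hm1 hm2 γ hγ hrat hhodge e he hfix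

end Summit.HodgeConjecture.HodgeConjecture.Theses.EndoscopicMiddleDegree
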